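import Mathlib.MeasureTheory.Measure.Lebesgue.EqHaar
import Summits.AtomisticToContinuum.Crystallization.Theorems.ExcessDecayLiouvillePhononStabilityDefs
import Summits.AtomisticToContinuum.Crystallization.Theorems.ExcessDecayLiouvillePhononStabilityFarDefs
import Summits.AtomisticToContinuum.Crystallization.Theorems.ExcessDecayLiouvillePhononStabilityLabels
import Summits.AtomisticToContinuum.Crystallization.Theorems.ExcessDecayLiouvillePhononStabilityPullbackBonds

/-!
# `PhononStability` (stmt-AtomisticToContinuum-9333), line `contragredient-window-collapse`: stub `stub_latticeCount`

Sub-goal S8 (`LatticeCount`) of the reshaped line (far-field vocabulary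
`ExcessDecayLiouvillePhononStabilityFarDefs.lean`): a PACKING COUNT for shifted copies of the hcp period lattice
`Λ = latVec ℤ³ = ℤu + ℤv + ℤ·2√(2/3)e₃`.  For every shift `y ∈ ℝ³`, every radius `ρ ≥ 0` and every finite set
`s ⊆ ℤ³` with `‖latVec n + y‖ ≤ ρ` for all `n ∈ s`, one has `#s ≤ (2ρ + 1)³`.

Proof (volume comparison, the argument of Mathlib's `Besicovitch.card_le_of_separated`): distinct points
`latVec n + y`, `latVec n' + y` are at distance `‖latVec (n − n')‖ ≥ 1` (landed `PullbackStub.one_le_norm_latVec`,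
`LabelsStub.latVec_sub`), so the open balls of radius `1/2` around them are pairwise disjoint, and they all lie in
the ball of radius `ρ + 1/2` around the origin.  With an additive Haar measure `μ` on `ℝ³`,
`μ (ball x r) = r³ · μ (ball 0 1)`, hence `#s · (1/2)³ ≤ (ρ + 1/2)³`, i.e. `#s ≤ (2ρ + 1)³`.

The count feeds the dyadic-shell estimate of the analytic far-far tail (`TailSum`).  All `[folklore]`.
-/

noncomputable section

open scoped BigOperators Classical InnerProductSpace ENNReal
open Filter Set Function
open MeasureTheory Metric Module
open Literature.MathematicalPhysics.StatisticalMechanics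
open Summit.AtomisticToContinuum.Crystallization.Theses.ExcessDecayLiouville
open Summit.AtomisticToContinuum.Crystallization.Theorems.PhononStabilityNegative
open Summit.AtomisticToContinuum.Crystallization.Theorems.PhononStabilityCWC

namespace Summit.AtomisticToContinuum.Crystallization.Theorems.PhononStabilityCWC.LatticeCountStub

/-! ## Separation of the shifted lattice -/

/-- Distinct points of a shifted copy of the period lattice are at distance `≥ 1`:
`dist (latVec n + y) (latVec n' + y) = ‖latVec (n − n')‖ ≥ 1` for `n ≠ n'`. [folklore] -/
theorem one_le_dist_latVec_add {n n' : Fin 3 → ℤ} (h : n ≠ n') (y : EuclideanSpace ℝ (Fin 3)) :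
    1 ≤ dist (latVec n + y) (latVec n' + y) := by
  rw [dist_eq_norm, add_sub_add_right_eq_sub, ← LabelsStub.latVec_sub]
  exact PullbackStub.one_le_norm_latVec (sub_ne_zero.mpr h)

/-- The open balls of radius `1/2` around the points `latVec n + y`, `n ∈ s`, are pairwise disjoint. [folklore] -/
theorem pairwiseDisjoint_ball (y : EuclideanSpace ℝ (Fin 3)) (s : Finset (Fin 3 → ℤ)) :
    (s : Set (Fin 3 → ℤ)).PairwiseDisjoint fun n => ball (latVec n + y) (1 / 2) := by
  intro n _ n' _ hne
  apply ball_disjoint_ball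
  have h1 := one_le_dist_latVec_add hne y
  linarith

/-- The balls of radius `1/2` around points of norm `≤ ρ` lie in the ball of radius `ρ + 1/2` around `0`. [folklore] -/
theorem biUnion_ball_subset (y : EuclideanSpace ℝ (Fin 3)) (ρ : ℝ) (s : Finset (Fin 3 → ℤ))
    (hs : ∀ n ∈ s, ‖latVec n + y‖ ≤ ρ) :
    (⋃ n ∈ s, ball (latVec n + y) (1 / 2)) ⊆ ball (0 : EuclideanSpace ℝ (Fin 3)) (ρ + 1 / 2) := by
  refine iUnion₂_subset fun n hn => ball_subset_ball' ?_
  rw [dist_zero_right]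
  linarith [hs n hn]

/-! ## The stub -/

/-- **S8 — lattice count (`stub_latticeCount`).** For `y ∈ ℝ³`, `ρ ≥ 0` and a finite `s ⊆ ℤ³` with
`‖latVec n + y‖ ≤ ρ` on `s`: `#s ≤ (2ρ + 1)³` (disjoint balls of radius `1/2` inside the ball of radius `ρ + 1/2`;
Haar measure scales like `r³`). [folklore] -/
theorem stub_latticeCount : LatticeCount := by
  intro y ρ hρ s hs
  -- adapted from Mathlib's `Besicovitch.card_le_of_separated`
  let μ : Measure (EuclideanSpace ℝ (Fin 3)) := Measure.addHaar
  have δpos : (0 : ℝ) < 1 / 2 := by norm_num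
  have ρpos : (0 : ℝ) < ρ + 1 / 2 := by linarith
  have hd : finrank ℝ (EuclideanSpace ℝ (Fin 3)) = 3 := finrank_euclideanSpace_fin
  have I : (s.card : ℝ≥0∞) * ENNReal.ofReal ((1 / 2) ^ 3) * μ (ball 0 1) ≤
      ENNReal.ofReal ((ρ + 1 / 2) ^ 3) * μ (ball 0 1) :=
    calc (s.card : ℝ≥0∞) * ENNReal.ofReal ((1 / 2) ^ 3) * μ (ball 0 1)
        = μ (⋃ n ∈ s, ball (latVec n + y) (1 / 2)) := by
          rw [measure_biUnion_finset (pairwiseDisjoint_ball y s) fun n _ => measurableSet_ball]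
          simp only [μ.addHaar_ball_of_pos _ δpos, hd, Finset.sum_const, nsmul_eq_mul, mul_assoc]
      _ ≤ μ (ball (0 : EuclideanSpace ℝ (Fin 3)) (ρ + 1 / 2)) := measure_mono (biUnion_ball_subset y ρ s hs)
      _ = ENNReal.ofReal ((ρ + 1 / 2) ^ 3) * μ (ball 0 1) := by
          rw [μ.addHaar_ball_of_pos _ ρpos, hd]
  have J : (s.card : ℝ≥0∞) * ENNReal.ofReal ((1 / 2) ^ 3) ≤ ENNReal.ofReal ((ρ + 1 / 2) ^ 3) :=
    (ENNReal.mul_le_mul_iff_left (measure_ball_pos μ _ zero_lt_one).ne' measure_ball_lt_top.ne).1 I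
  have K : (s.card : ℝ) * (1 / 2) ^ 3 ≤ (ρ + 1 / 2) ^ 3 := by
    have h := ENNReal.toReal_le_of_le_ofReal (pow_nonneg ρpos.le _) J
    rwa [ENNReal.toReal_mul, ENNReal.toReal_ofReal (pow_nonneg δpos.le _), ENNReal.toReal_natCast] at h
  calc (s.card : ℝ) = 8 * ((s.card : ℝ) * (1 / 2) ^ 3) := by ring
    _ ≤ 8 * (ρ + 1 / 2) ^ 3 := by gcongr
    _ = (2 * ρ + 1) ^ 3 := by ring

end Summit.AtomisticToContinuum.Crystallization.Theorems.PhononStabilityCWC.LatticeCountStub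

end
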